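import Literature.AlgebraicGeometry.Resolution.Lipman1969NegativeDefinite
import Literature.AlgebraicGeometry.Resolution.ExceptionalFibreConnected
import HarnessLib

/-!
# Lipman 1969 §14: closed points of a resolution have codimension two — PROOF of the named fact

Topic: `Literature/AlgebraicGeometry/Resolution`. PROVES the named fact `Lipman1969_14_closedPoint`
(`Resolution/Lipman1969NegativeDefinite.lean`, Lipman 1969 §14, p. 224: "every closed point on `X` is of
codimension two"): for `S` a two-dimensional Noetherian normal local domain and `π : X → Spec S` a
resolution, every closed point `x ∈ X` has `coheight x = 2`. Upper bound `height + coheight ≤ dim X ≤ 2`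
(`IsResolution.height_add_coheight_le_two`); lower bound from a chain `x < x₁ < ξ`: either a maximal point
of the closed fibre properly generises `x`, or `x` is an isolated point of the closed fibre, which is then
`{x}` by Zariski connectedness (`IsResolution.isPreconnected_closedFibre`), and a point over a height-one
prime of `S` (`π` is surjective) specialises to `x`. No new definitions.

## References

* J. Lipman, *Rational singularities, with applications to algebraic surfaces and unique factorization*,
  Publ. Math. IHÉS 36 (1969) 195–279, §14 (p. 224). [Lipman1969]
-/

noncomputable section

open CategoryTheory CategoryTheory.Limits AlgebraicGeometry TopologicalSpace Topology IsLocalRing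

universe u

namespace Literature.AlgebraicGeometry.Resolution

namespace Lipman1969_14_closedPoint_holds_aux

variable {T : Type u} [CommRing T] [IsLocalRing T] {X : Scheme.{u}} {π : X ⟶ Spec (.of T)}

/-- Over a local base, every point of a proper `X → Spec T` specialises to a closed point of `X`
lying in the closed fibre. (Copy of the private lemma of `ExceptionalFibreConnected`.) [folklore] -/
private theorem exists_isClosed_specializes [IsProper π] (x : X) :
    ∃ c : X, x ⤳ c ∧ IsClosed ({c} : Set X) ∧ π.base c = closedPoint T := by
  haveI : CompactSpace X := QuasiCompact.compactSpace_of_compactSpace π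
  obtain ⟨c, hc, hccl⟩ := (isClosed_closure (s := ({x} : Set X))).exists_closed_singleton
    ⟨x, subset_closure rfl⟩
  refine ⟨c, specializes_iff_mem_closure.mpr hc, hccl, ?_⟩
  have himg : IsClosed ({π.base c} : Set (Spec (.of T))) := by
    have := π.isClosedMap _ hccl
    rwa [Set.image_singleton] at this
  have hmax := (PrimeSpectrum.isClosed_singleton_iff_isMaximal (π.base c)).mp himg
  exact PrimeSpectrum.ext (IsLocalRing.eq_maximalIdeal hmax)

/-- A closed point of a proper `X → Spec T` (`T` local) lies in the closed fibre. [folklore] -/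
private theorem base_eq_closedPoint_of_isClosed [IsProper π] {x : X} (hx : IsClosed ({x} : Set X)) :
    π.base x = closedPoint T := by
  obtain ⟨c, hxc, -, hc⟩ := exists_isClosed_specializes (π := π) x
  have : c ∈ ({x} : Set X) := hx.closure_subset (specializes_iff_mem_closure.mp hxc)
  rw [Set.mem_singleton_iff] at this
  rwa [this] at hc

/-- In the specialisation preorder of a scheme, a proper specialisation is strictly smaller. [folklore] -/
private theorem lt_of_specializes_of_ne {x y : X} (h : y ⤳ x) (hne : x ≠ y) : x < y :=
  ⟨Scheme.le_iff_specializes.2 h, fun h' => hne ((Scheme.le_iff_specializes.1 h').antisymm h).eq⟩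

end Lipman1969_14_closedPoint_holds_aux

open Lipman1969_14_closedPoint_holds_aux in
/-- **Lipman 1969 §14 (p. 224): closed points of a resolution of a two-dimensional normal local domain have
codimension two.** Upper bound: `height + coheight ≤ dim X ≤ 2`. Lower bound: a closed point `x` lies in the
closed fibre `E`; either a maximal point `η ≠ x` of `E` generises it (and `η` is not the generic point), or
`x` is an isolated point of `E`, whence `E = {x}` by Zariski connectedness, and then a point `x₁` over a
height-one prime of `S` (which exists as `π` is surjective) specialises to the unique closed point `x`;
in both cases `x < x₁ < ξ` gives `coheight x ≥ 2`. [cite: Lipman1969, Section 14 (p. 224)] -/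
theorem Lipman1969_14_closedPoint_holds : Lipman1969_14_closedPoint.{u} := by
  intro S _ _ _ _ _ h2 X _ _ π hπ x hx
  haveI : IsProper π := hπ.isProper
  haveI : IsDominant π := hπ.isBirational.isDominant
  have hπx : π.base x = closedPoint S := base_eq_closedPoint_of_isClosed hx
  -- upper bound
  have hup : Order.coheight x ≤ 2 :=
    le_trans le_add_self (hπ.height_add_coheight_le_two h2.le x)
  refine le_antisymm hup ?_
  -- a chain `⊥ < 𝔭 < 𝔪` of primes of `S`
  have hdim : ((2 : ℕ) : WithBot ℕ∞) ≤ Order.krullDim (PrimeSpectrum S) := by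
    change ((2 : ℕ) : WithBot ℕ∞) ≤ ringKrullDim S
    rw [h2]; exact le_rfl
  obtain ⟨l, hl⟩ := Order.le_krullDim_iff.mp hdim
  have h01 : l ⟨0, by omega⟩ < l ⟨1, by omega⟩ := l.strictMono (Fin.mk_lt_mk.2 (by omega))
  have h12 : l ⟨1, by omega⟩ < l ⟨2, by omega⟩ := l.strictMono (Fin.mk_lt_mk.2 (by omega))
  set 𝔭 : PrimeSpectrum S := l ⟨1, by omega⟩ with h𝔭def
  have h𝔭bot : 𝔭 ≠ ⊥ := ne_bot_of_gt h01
  have h𝔭max : 𝔭 ≠ closedPoint S := by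
    intro h
    have hM : IsMax (closedPoint S) := PrimeSpectrum.isMax_iff.mpr (IsLocalRing.maximalIdeal.isMaximal S)
    exact (hM.not_lt) (h ▸ h12)
  have hbot_ne_closed : (⊥ : PrimeSpectrum S) ≠ closedPoint S := by
    intro h
    have hle : 𝔭 ≤ closedPoint S := IsLocalRing.le_maximalIdeal 𝔭.isPrime.ne_top
    exact h𝔭bot (le_antisymm (h ▸ hle) bot_le)
  -- the generic point of `X` maps to `⊥`
  have hξ : π.base (genericPoint X) = (⊥ : PrimeSpectrum S) := by
    have := Motives.RatFn.genericPoint_eq_of_isDominant π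
    rw [genericPoint_eq_bot_of_affine] at this
    exact this
  -- it suffices to find `x₁` with `x₁ ⤳ x`, `x₁ ≠ x`, `x₁ ≠ ξ`
  suffices H : ∃ x₁ : X, x₁ ⤳ x ∧ x₁ ≠ x ∧ x₁ ≠ genericPoint X by
    obtain ⟨x₁, hx₁x, hne, hneξ⟩ := H
    have hlt1 : x < x₁ := lt_of_specializes_of_ne hx₁x (Ne.symm hne)
    have hlt2 : x₁ < genericPoint X := lt_of_specializes_of_ne (genericPoint_specializes x₁) hneξ
    have ha := Order.coheight_add_one_le hlt1
    have hb := Order.coheight_add_one_le hlt2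
    have h1 : (1 : ℕ∞) ≤ Order.coheight x₁ := le_trans le_add_self hb
    calc (2 : ℕ∞) = 1 + 1 := by norm_num
      _ ≤ Order.coheight x₁ + 1 := add_le_add h1 le_rfl
      _ ≤ Order.coheight x := ha
  -- the closed fibre and a maximal point of it above `x`
  set E : Set X := π.base ⁻¹' {closedPoint S} with hEdef
  have hE : IsClosed E := (isClosed_singleton_closedPoint S).preimage π.continuous
  obtain ⟨η, hηmax, hηx⟩ := exists_mem_maxPoints_specializes hE (show x ∈ E from hπx)
  have hηexc : η ∈ excPoints π := hηmax
  by_cases hηx' : η = x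
  swap
  · refine ⟨η, hηx, hηx', fun h => ?_⟩
    have : π.base η = closedPoint S := hηexc.1
    rw [h, hξ] at this
    exact hbot_ne_closed this
  -- `x` is an isolated maximal point of `E`: then `E = {x}` by connectedness
  subst hηx'
  set F : Set X := ⋃ η' ∈ excPoints π \ {η}, closure {η'} with hFdef
  have hF : IsClosed F :=
    ((excPoints_finite π).subset fun _ h => h.1).isClosed_biUnion fun _ _ => isClosed_closure
  have hEsub : E ⊆ {η} ∪ F := fun z hz => by
    obtain ⟨η', hη'max, hη'z⟩ := exists_mem_maxPoints_specializes hE hz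
    by_cases hη'η : η' = η
    · subst hη'η
      left
      exact hx.closure_subset (specializes_iff_mem_closure.mp hη'z)
    · right
      exact Set.mem_biUnion (show η' ∈ excPoints π \ {η} from ⟨hη'max, hη'η⟩)
        (specializes_iff_mem_closure.mp hη'z)
  have hdisj : ∀ z ∈ E, z ∈ ({η} : Set X) → z ∈ F → False := by
    rintro z - rfl hzF
    obtain ⟨η', hη', hzη'⟩ := Set.mem_iUnion₂.mp hzF
    have hsp : η' ⤳ z := specializes_iff_mem_closure.mpr hzη'
    exact hη'.2 (hηmax.2 η' hη'.1.1 hsp)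
  have hEη : E ⊆ {η} := fun z hz => by
    rcases hEsub hz with h | h
    · exact h
    · exfalso
      have hne : (E ∩ {η}).Nonempty := ⟨η, hηexc.1, rfl⟩
      obtain ⟨w, hwE, hwη, hwF⟩ := (isPreconnected_closed_iff.mp (hπ.isPreconnected_closedFibre))
        {η} F hx hF hEsub hne ⟨z, hz, h⟩
      exact hdisj w hwE hwη hwF
  -- `π` is surjective (closed map with dense image); take `x₁` over `𝔭`
  have hrange : Set.range π.base = Set.univ := by
    have hcl : IsClosed (Set.range π.base) := π.isClosedMap.isClosed_range
    rw [← hcl.closure_eq]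
    exact π.denseRange.closure_range
  obtain ⟨x₁, hx₁⟩ : (𝔭 : ↥(Spec (.of S))) ∈ Set.range π.base := by rw [hrange]; trivial
  obtain ⟨c, hx₁c, -, hc⟩ := exists_isClosed_specializes (π := π) x₁
  have hcη : c = η := by
    have : c ∈ E := hc
    exact Set.mem_singleton_iff.mp (hEη this)
  refine ⟨x₁, hcη ▸ hx₁c, fun h => h𝔭max ?_, fun h => h𝔭bot ?_⟩
  · rw [← hx₁, h]; exact hηexc.1
  · rw [← hx₁, h, hξ]

end Literature.AlgebraicGeometry.Resolution

end
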